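import Literature.Topology.PlaneTopology.OpenSetArcs
import Literature.Topology.PlaneTopology.SimpleArcs
import Mathlib.Analysis.Convex.Segment
import HarnessLib

/-!
# The middle arc of the cross-cut — helper for `DiscretisationFamilyExists` (stmt-CriticalPhenomena-9644)

`exists_mid_arc`: given two disjoint closed segments (the runs of the two legs) `[mₐ, zₐ]`,
`[m_b, z_b]` and an open preconnected set `C` containing `zₐ, z_b` but not `mₐ, m_b`, there is a
simple arc `M ⊆ C` from a point `wₐ ≠ mₐ` of the first run to a point `w_b ≠ m_b` of the second,
meeting the first run only in `wₐ` and the second only in `w_b` (an arc in `C` from `zₐ` to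
`z_b`, trimmed at its last visit to the first run and its next visit to the second).
-/

noncomputable section

open Set Metric
open Literature.Topology.PlaneTopology

namespace Summit.CriticalPhenomena.CardyFormulaZ2.Theorems.DiscretisationFamilyExists

/-- A closed segment of the plane is closed. [folklore] -/
theorem isClosed_segment' (x y : ℂ) : IsClosed (segment ℝ x y) := by
  rw [segment_eq_image']
  refine (isCompact_Icc.image ?_).isClosed
  fun_prop

/-- **Last visit**: along a path from a point of the closed set `A` to a point outside it there
is a last parameter in `A`. [folklore] -/
theorem exists_last_hit {γ : ℝ → ℂ} (hγ : ContinuousOn γ (Icc 0 1)) {A : Set ℂ} (hA : IsClosed A)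
    (h0 : γ 0 ∈ A) (h1 : γ 1 ∉ A) :
    ∃ s₁ ∈ Ico (0 : ℝ) 1, γ s₁ ∈ A ∧ ∀ s ∈ Ioc s₁ 1, γ s ∉ A := by
  have hrev : ContinuousOn (fun u => γ (1 - u)) (Icc 0 1) := by
    refine hγ.comp (continuousOn_const.sub continuousOn_id) fun u hu => ?_
    exact ⟨by linarith [hu.2], by linarith [hu.1]⟩
  obtain ⟨u₁, hu₁, hu₁A, hbefore⟩ := exists_first_hit hrev hA (by simpa using h1) (by simpa using h0)
  refine ⟨1 - u₁, ⟨by linarith [hu₁.2], by linarith [hu₁.1]⟩, hu₁A, fun s hs hsA => ?_⟩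
  have := hbefore (1 - s) ⟨by linarith [hs.2], by linarith [hs.1]⟩
  rw [sub_sub_cancel] at this
  exact this hsA

/-- **The middle arc.** See the module docstring. [folklore] -/
theorem exists_mid_arc {C : Set ℂ} (hC : IsOpen C) (hCc : IsPreconnected C) {ma za mb zb : ℂ}
    (hza : za ∈ C) (hzb : zb ∈ C) (hma : ma ∉ C) (hmb : mb ∉ C)
    (hdisj : Disjoint (segment ℝ ma za) (segment ℝ mb zb)) :
    ∃ wa ∈ segment ℝ ma za, ∃ wb ∈ segment ℝ mb zb, ∃ M : Set ℂ, IsSimpleArc M wa wb ∧ M ⊆ C ∧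
      M ∩ segment ℝ ma za = {wa} ∧ M ∩ segment ℝ mb zb = {wb} ∧ wa ≠ ma ∧ wb ≠ mb := by
  have hzab : za ≠ zb := fun h =>
    Set.disjoint_left.1 hdisj (right_mem_segment ℝ ma za) (h ▸ right_mem_segment ℝ mb zb)
  obtain ⟨L, hLC, hL⟩ := exists_isSimpleArc_of_isOpen hC hCc hza hzb hzab
  obtain ⟨γ, hγ, hinj, hLeq, h0, h1⟩ := hL
  have hγC : ∀ s ∈ Icc (0 : ℝ) 1, γ s ∈ C := fun s hs => hLC (hLeq ▸ mem_image_of_mem γ hs)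
  have hRa : IsClosed (segment ℝ ma za) := isClosed_segment' ma za
  have hRb : IsClosed (segment ℝ mb zb) := isClosed_segment' mb zb
  -- last visit to the first run
  have h1a : γ 1 ∉ segment ℝ ma za := fun h =>
    Set.disjoint_left.1 hdisj h (h1 ▸ right_mem_segment ℝ mb zb)
  obtain ⟨s₁, hs₁, hs₁a, hafter⟩ := exists_last_hit hγ hRa (h0 ▸ right_mem_segment ℝ ma za) h1a
  -- next visit to the second run
  set η : ℝ → ℂ := fun u => γ (s₁ + u * (1 - s₁)) with hη
  have hmem : ∀ u ∈ Icc (0 : ℝ) 1, s₁ + u * (1 - s₁) ∈ Icc s₁ 1 := fun u hu =>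
    ⟨by nlinarith [hu.1, hs₁.2], by nlinarith [hu.2, hs₁.2, hs₁.1]⟩
  have hηc : ContinuousOn η (Icc 0 1) := by
    refine hγ.comp (Continuous.continuousOn (by fun_prop)) fun u hu => ?_
    exact ⟨hs₁.1.trans (hmem u hu).1, (hmem u hu).2⟩
  have hη0 : η 0 ∉ segment ℝ mb zb := by
    simp only [hη, zero_mul, add_zero]
    exact fun h => Set.disjoint_left.1 hdisj hs₁a h
  have hη1 : η 1 ∈ segment ℝ mb zb := by
    simp only [hη, one_mul, add_sub_cancel, h1]; exact right_mem_segment ℝ mb zb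
  obtain ⟨u₂, hu₂, hu₂b, hbefore⟩ := exists_first_hit hηc hRb hη0 hη1
  set t₁ := s₁ + u₂ * (1 - s₁) with ht₁
  have hst : s₁ < t₁ := by rw [ht₁]; nlinarith [hu₂.1, hs₁.2]
  have ht₁1 : t₁ ≤ 1 := (hmem u₂ ⟨hu₂.1.le, hu₂.2⟩).2
  -- the arc
  refine ⟨γ s₁, hs₁a, γ t₁, hu₂b, γ '' Icc s₁ t₁, isSimpleArc_image_Icc hγ hinj hs₁.1 hst ht₁1,
    fun z ⟨s, hs, hz⟩ => hz ▸ hγC s ⟨hs₁.1.trans hs.1, hs.2.trans ht₁1⟩, ?_, ?_, ?_, ?_⟩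
  · refine Subset.antisymm ?_ (singleton_subset_iff.2 ⟨mem_image_of_mem γ (left_mem_Icc.2 hst.le), hs₁a⟩)
    rintro z ⟨⟨s, hs, rfl⟩, hz⟩
    rcases eq_or_lt_of_le hs.1 with h | h
    · rw [← h]; rfl
    · exact absurd hz (hafter s ⟨h, hs.2.trans ht₁1⟩)
  · refine Subset.antisymm ?_ (singleton_subset_iff.2 ⟨mem_image_of_mem γ (right_mem_Icc.2 hst.le), hu₂b⟩)
    rintro z ⟨⟨s, hs, rfl⟩, hz⟩
    rcases eq_or_lt_of_le hs.2 with h | h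
    · rw [h]; rfl
    · -- `s = s₁ + u (1 - s₁)` with `u < u₂`
      exfalso
      have h1s : 0 < 1 - s₁ := by linarith [hs₁.2]
      set u := (s - s₁) / (1 - s₁) with hu
      have hsu : s = s₁ + u * (1 - s₁) := by rw [hu]; field_simp; ring
      have hu0 : 0 ≤ u := div_nonneg (by linarith [hs.1]) h1s.le
      have huu₂ : u < u₂ := by
        rw [hu, div_lt_iff₀ h1s]; rw [ht₁] at h; linarith
      have := hbefore u ⟨hu0, huu₂⟩
      rw [hη] at this; simp only at this
      rw [← hsu] at this
      exact this hz
  · exact fun h => hma (h ▸ hγC s₁ ⟨hs₁.1, hs₁.2.le⟩)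
  · exact fun h => hmb (h ▸ hγC t₁ ⟨hs₁.1.trans hst.le, ht₁1⟩)

/-- **Sub-runs**: a point of the run cuts off an initial segment inside the run. [folklore] -/
theorem segment_subset_of_mem {m z w : ℂ} (hw : w ∈ segment ℝ m z) : segment ℝ m w ⊆ segment ℝ m z :=
  (convex_segment m z).segment_subset (left_mem_segment ℝ m z) hw

end Summit.CriticalPhenomena.CardyFormulaZ2.Theorems.DiscretisationFamilyExists

end
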